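import Mathlib
import HarnessLib
import Summits.MatrixMultiplication.MatrixMultiplication.Theses.NilCoxeterShadow
import Summits.MatrixMultiplication.MatrixMultiplication.Theorems.NilCoxeterShadowAThesisOfInductiveCosetGrowth

/-!
# `AThesis` (crux stmt-MatrixMultiplication-0956, route NilCoxeterShadow): false modulo `PolynomialExcess`

Negative-side glue of line `birth` (lead prover), `sorry`-free. The route files the tameness statement
`PolynomialExcess` (stmt-MatrixMultiplication-0960, NEGATIVE side: `∃ C k, ∀ n ≥ 1, bR(T_{NC_n}) ≤ C·n^k·n!`)
as the kill criterion of the whole line ("proving it refutes X_NC and closes the route"); this file makes the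
two implications kernel-checked, by name:

* `AThesis_false_of_PolynomialExcess : PolynomialExcess → ¬ AThesis` — `(n!)^(1+δ) ≤ bR(T_{NC_n}) ≤ C n^k n!`
  for infinitely many `n` would give `(n!)^δ ≤ C n^k` infinitely often, impossible since `n! ≥ 2^n / 2`
  makes `(n!)^δ ≥ (2^δ)^n / 2^δ` exponential in `n` (`eventually_mul_pow_lt_factorial_rpow`, from Mathlib's
  `tendsto_pow_const_div_const_pow_of_one_lt`);
* `InductiveCosetGrowth_false_of_PolynomialExcess : PolynomialExcess → ¬ InductiveCosetGrowth` — through the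
  landed glue `aThesis_of_inductiveCosetGrowth` (stmt-0958 ⟹ stmt-0956).

So a proof of stmt-0960 closes stmt-0956 AND stmt-0958 as refuted; conversely any proof of the line must in
particular refute the tameness of the shadow.
-/

-- `Summit.<Summit>.<Problem>`: for the single-conjunct summit the duplicate component is mandated.
set_option linter.dupNamespace false

namespace Summit.MatrixMultiplication.MatrixMultiplication.Theorems.AThesis.Negative

open Filter Topology
open Summit.MatrixMultiplication.MatrixMultiplication.Theses.NilCoxeterShadow

/-- `2^n ≤ 2 · n!`. [folklore] -/
theorem two_pow_le_two_mul_factorial (n : ℕ) : 2 ^ n ≤ 2 * n.factorial := by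
  induction n with
  | zero => simp
  | succ m ih =>
    rcases Nat.eq_zero_or_pos m with rfl | hm
    · simp
    · calc 2 ^ (m + 1) = 2 * 2 ^ m := by ring
        _ ≤ 2 * (2 * m.factorial) := Nat.mul_le_mul_left 2 ih
        _ ≤ 2 * ((m + 1) * m.factorial) :=
            Nat.mul_le_mul_left 2 (Nat.mul_le_mul_right _ (by omega))
        _ = 2 * (m + 1).factorial := by rw [Nat.factorial_succ]

/-- **A polynomial is eventually below any positive power of the factorial**: for `δ > 0`, `C : ℝ`, `k : ℕ`
there is `N` with `C · n^k < (n!)^δ` for all `n ≥ N`. Proof: `r = 2^δ > 1`, `n^k / r^n → 0`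
(`tendsto_pow_const_div_const_pow_of_one_lt`), and `(n!)^δ ≥ (2^n/2)^δ = r^n / r`. [folklore] -/
theorem eventually_mul_pow_lt_factorial_rpow (δ : ℝ) (hδ : 0 < δ) (C : ℝ) (k : ℕ) :
    ∃ N : ℕ, ∀ n : ℕ, N ≤ n → C * (n : ℝ) ^ k < ((n.factorial : ℕ) : ℝ) ^ δ := by
  set r : ℝ := (2 : ℝ) ^ δ with hr
  have hr1 : 1 < r := Real.one_lt_rpow (by norm_num) hδ
  have hr0 : 0 < r := zero_lt_one.trans hr1
  have h : Tendsto (fun n : ℕ => (n : ℝ) ^ k / r ^ n) atTop (𝓝 0) :=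
    tendsto_pow_const_div_const_pow_of_one_lt k hr1
  have hε : (0 : ℝ) < 1 / ((|C| + 1) * r) := by positivity
  obtain ⟨N, hN⟩ := eventually_atTop.1 (h.eventually (eventually_lt_nhds hε))
  refine ⟨N, fun n hn => ?_⟩
  have hNn := hN n hn
  have hrn : 0 < r ^ n := pow_pos hr0 n
  rw [div_lt_div_iff₀ hrn (by positivity), one_mul] at hNn
  -- `hNn : (n:ℝ)^k * ((|C|+1) * r) < r ^ n`
  have hpow : 0 ≤ (n : ℝ) ^ k := by positivity
  -- `(n!)^δ ≥ r^n / r`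
  have hfac : r ^ n / r ≤ ((n.factorial : ℕ) : ℝ) ^ δ := by
    have h2 : (2 : ℝ) ^ n ≤ 2 * ((n.factorial : ℕ) : ℝ) := by
      exact_mod_cast two_pow_le_two_mul_factorial n
    have h3 : (2 : ℝ) ^ n / 2 ≤ ((n.factorial : ℕ) : ℝ) := by linarith
    have h4 : ((2 : ℝ) ^ n / 2) ^ δ ≤ ((n.factorial : ℕ) : ℝ) ^ δ :=
      Real.rpow_le_rpow (by positivity) h3 hδ.le
    have h5 : ((2 : ℝ) ^ n / 2) ^ δ = r ^ n / r := by
      rw [Real.div_rpow (by positivity) (by norm_num), hr, ← Real.rpow_natCast ((2 : ℝ) ^ δ) n,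
        ← Real.rpow_mul (by norm_num : (0 : ℝ) ≤ 2), ← Real.rpow_natCast (2 : ℝ) n,
        ← Real.rpow_mul (by norm_num : (0 : ℝ) ≤ 2), mul_comm]
    rw [h5] at h4
    exact h4
  have hmain : C * (n : ℝ) ^ k < r ^ n / r := by
    rw [lt_div_iff₀ hr0]
    calc C * (n : ℝ) ^ k * r ≤ |C| * (n : ℝ) ^ k * r := by
          have := mul_le_mul_of_nonneg_right (le_abs_self C) hpow
          nlinarith
      _ ≤ (n : ℝ) ^ k * ((|C| + 1) * r) := by nlinarith
      _ < r ^ n := hNn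
  exact hmain.trans_le hfac

/-- **`PolynomialExcess → ¬ AThesis`** (kill criterion of route `NilCoxeterShadow`, items stmt-0960 / stmt-0956
BY NAME): tameness `bR(T_{NC_n}) ≤ C n^k n!` of the nil-Coxeter shadow contradicts a super-polynomial border
rank `(n!)^(1+δ) ≤ bR(T_{NC_n})` at any large `n`, since `(n!)^δ` eventually exceeds `C n^k`
(`eventually_mul_pow_lt_factorial_rpow`). [folklore] -/
theorem AThesis_false_of_PolynomialExcess : PolynomialExcess → ¬ AThesis := by
  rintro ⟨C, k, hC⟩ ⟨δ, hδ, hinf⟩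
  obtain ⟨N, hN⟩ := eventually_mul_pow_lt_factorial_rpow δ hδ (C : ℝ) k
  obtain ⟨n, hn, hle⟩ := hinf (max N 1)
  have hNn : N ≤ n := le_trans (le_max_left _ _) hn
  have hn1 : 1 ≤ n := le_trans (le_max_right _ _) hn
  have hCn := (Nat.cast_le (α := ℝ)).mpr (hC n hn1)
  push_cast at hCn
  -- `hle : (n!)^(1+δ) ≤ bR`, `hCn : bR ≤ C * n^k * n!`
  have hfpos : (0 : ℝ) < ((n.factorial : ℕ) : ℝ) := by exact_mod_cast n.factorial_pos
  have h1 : ((n.factorial : ℕ) : ℝ) ^ (1 + δ) ≤ (C : ℝ) * (n : ℝ) ^ k * ((n.factorial : ℕ) : ℝ) := by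
    have := hle.trans hCn
    exact_mod_cast this
  rw [Real.rpow_add hfpos, Real.rpow_one, mul_comm] at h1
  have h2 : ((n.factorial : ℕ) : ℝ) ^ δ ≤ (C : ℝ) * (n : ℝ) ^ k :=
    le_of_mul_le_mul_right (by simpa [mul_comm, mul_assoc] using h1) hfpos
  exact absurd (hN n hNn) (not_lt.2 h2)

/-- **`PolynomialExcess → ¬ InductiveCosetGrowth`** (items stmt-0960 / stmt-0958 BY NAME): through the landed glue
`InductiveCosetGrowth → AThesis` (`aThesis_of_inductiveCosetGrowth`, stmt-0958 ⟹ stmt-0956). [folklore] -/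
theorem InductiveCosetGrowth_false_of_PolynomialExcess : PolynomialExcess → ¬ InductiveCosetGrowth :=
  fun hP hI => AThesis_false_of_PolynomialExcess hP
    (Summit.MatrixMultiplication.MatrixMultiplication.Theorems.AThesis.aThesis_of_inductiveCosetGrowth hI)

end Summit.MatrixMultiplication.MatrixMultiplication.Theorems.AThesis.Negative
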